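import Summits.Schanuel.Schanuel.Theorems.RootDecomp1ModularWitness

/-!
# RootDecomp1 — NON-MODULARITY of `(ℂ, acl)` (lens-1 round 11, part B; `--supports stmt-Schanuel-30352`)

Pillay, Geometric Stability Theory, Ch. 2, Example 1.8, over `ℚ`: for algebraically independent `u, v, w` the algebraically
closed fields `ℚ(u, v)^alg` (trdeg 2) and `ℚ(uw + v, w)^alg` (trdeg 2) generate a field of trdeg 3, yet meet in `ℚ̄`
(`isAlgebraic_of_nonmodular`; proof by the `w ↦ w + 1` specialisation of any relation `Q(s, w, uw+v) = 0` with `s ∈ ℚ(u,v)^alg`).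
`isAlgebraic_of_nonmodular₄` is the same with one extra independent parameter `f` on the second side (used for the exponential
instance in part C).  Helper lemmas: relation transport `relation_specialise`, `isAlgebraic_of_relation`,
`natCast_succ_le_trdeg_adjoin_insert`.
-/

set_option linter.dupNamespace false

noncomputable section

namespace Summit.Schanuel.Schanuel.Theorems.RootDecomp1ModularLayer

open Complex IntermediateField
open scoped BigOperators Cardinal
open Summit.Schanuel.Schanuel.Theorems.RootDecomp1EAnchor (isAlgebraic_of_trdeg_sandwich trdeg_adjoin_le_of_isAlgebraic
  trdeg_adjoin_union_le trdeg_adjoin_le_nat exists_nat_eq_of_le_natCast isAlgebraic_of_mem_adjoin isAlgebraic_of_le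
  isAlgebraic_of_isAlgebraic_adjoin trdeg_adjoin_sum_le_union one_le_trdeg_adjoin_singleton)
open Summit.Schanuel.Schanuel.Theorems.RootDecomp1ArgumentCells (le_trdeg_of_algebraicIndependent_mem)
open Summit.Schanuel.Schanuel.Theorems.RootDecomp1AtomRigidity (mem_adjoin_range_of_mem_span_int
  exp_mem_adjoin_exp_of_mem_span_int)
open Summit.Schanuel.Schanuel.Theorems.RootDecomp1SharedDegree (trdeg_union_add_one_le_of_shared
  entangled_of_shared_transcendental lt_of_add_one_le_of_le_nat)
open Literature.NumberTheory.Transcendental (SchanuelRank transcendental_exp transcendental_exp_holds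
  exists_nsmul_mem_span_int isAlgebraic_adjoin_over_algebraAdjoin)
open Literature.NumberTheory.Transcendental.OneMotiveToric (trdeg_mono)
open Literature.Barriers.Schanuel (algebraicIndependent_of_le_trdeg_adjoin trdeg_adjoin_union_eq_of_isAlgebraic)

/-! ## §2  NON-MODULARITY — an ENTANGLED exponential configuration with NO modular witness (`ε = 1`, `μ = σ = 0`)

Pillay's example of the non-(local-)modularity of algebraic closure (Geometric Stability Theory, Ch. 2, Example 1.8, the
case `n = 1`): for algebraically independent `u, v, w` the algebraically closed fields `ℚ(u, v)^alg` (dimension 2) and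
`ℚ(w, uw + v)^alg` (dimension 2) sit in `ℚ(u, v, w)^alg` (dimension 3 < 2 + 2) but meet in `ℚ̄`: the dimension formula
`dim(A ∨ B) + dim(A ∧ B) = dim A + dim B` FAILS.  Transplanted to `exp`: with `z = (u, e^{u²} − u·e^u, u²)` one has
`ℚ(z)^alg = ℚ(u, v)^alg` and `ℚ(e^z) = ℚ(w, f, uw + v)` for `v = z₂`, `w = e^u`, `f = e^v` (because `e^{u²} = u·e^u + v`),
so under the generic-independence hypothesis `PillayHyp u` the tuple is ENTANGLED with NO modular witness. -/

/-- Differences of algebraic elements are algebraic. -/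
theorem isAlgebraic_sub {K : IntermediateField ℚ ℂ} {x y : ℂ} (hx : IsAlgebraic ↥K x) (hy : IsAlgebraic ↥K y) :
    IsAlgebraic ↥K (x - y) :=
  mem_algebraicClosure_iff.mp (sub_mem (mem_algebraicClosure_iff.mpr hx) (mem_algebraicClosure_iff.mpr hy))

/-- Products of algebraic elements are algebraic (private: print-twin of `RootDecomp1EAnchor.isAlgebraic_mul`, gate dedup;
later parts carry private copies). -/
private theorem isAlgebraic_mul' {K : IntermediateField ℚ ℂ} {x y : ℂ} (hx : IsAlgebraic ↥K x) (hy : IsAlgebraic ↥K y) :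
    IsAlgebraic ↥K (x * y) :=
  mem_algebraicClosure_iff.mp (mul_mem (mem_algebraicClosure_iff.mpr hx) (mem_algebraicClosure_iff.mpr hy))

/-- A field generated by an `m`-tuple has `trdeg ≤ m` (private: print-twin of a landed declaration, gate dedup; later parts
carry private copies). -/
private theorem trdeg_adjoin_range_le {m : ℕ} (x : Fin m → ℂ) : Algebra.trdeg ℚ ↥(adjoin ℚ (Set.range x)) ≤ (m : Cardinal) :=
  trdeg_adjoin_le_nat _ (by simpa using Cardinal.mk_range_le (f := x))

/-- `ℚ(x) ≤ L` as soon as every `x i ∈ L`. -/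
theorem adjoin_range_le {m : ℕ} {x : Fin m → ℂ} {L : IntermediateField ℚ ℂ} (h : ∀ i, x i ∈ L) :
    adjoin ℚ (Set.range x) ≤ L :=
  adjoin_le_iff.mpr (Set.range_subset_iff.mpr h)

/-- If `t ≤ trdeg ℚ(S)` and `x` is transcendental over `ℚ(S)` then `t + 1 ≤ trdeg ℚ(S ∪ {x})` (contrapositive of the defect
comparison `isAlgebraic_of_trdeg_sandwich`). [folklore] -/
theorem natCast_succ_le_trdeg_adjoin_insert {S : Set ℂ} {x : ℂ} {t : ℕ}
    (hS : (t : Cardinal) ≤ Algebra.trdeg ℚ ↥(adjoin ℚ S)) (hx : ¬ IsAlgebraic ↥(adjoin ℚ S) x)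
    (hfin : Algebra.trdeg ℚ ↥(adjoin ℚ (insert x S)) ≤ ((t + 1 : ℕ) : Cardinal)) :
    ((t + 1 : ℕ) : Cardinal) ≤ Algebra.trdeg ℚ ↥(adjoin ℚ (insert x S)) := by
  obtain ⟨k, hk, -⟩ := exists_nat_eq_of_le_natCast hfin
  rw [hk] at hfin ⊢
  by_contra hlt
  have hkt : k ≤ t := by
    have : ¬ (t + 1 ≤ k) := by exact_mod_cast hlt
    omega
  exact hx (isAlgebraic_of_trdeg_sandwich (subset_adjoin ℚ _ (Set.mem_insert x S)) (Set.subset_insert x S)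
    (t := t) (by rw [hk]; exact_mod_cast hkt) hS)

/-- RELATION TRANSPORT: a non-zero ℚ-relation `Q(d, w, s) = 0` with `(w, s)` algebraically independent makes `d` algebraic
over `ℚ(w, s)`. [folklore] -/
theorem isAlgebraic_of_relation {Q : MvPolynomial (Fin 3) ℚ} (hQ0 : Q ≠ 0) {d w s : ℂ}
    (hQ : MvPolynomial.aeval ![d, w, s] Q = 0) (hind : AlgebraicIndependent ℚ ![w, s]) :
    IsAlgebraic ↥(adjoin ℚ (Set.range ![w, s])) d := by
  by_contra hd
  have h2 : ((2 : ℕ) : Cardinal) ≤ Algebra.trdeg ℚ ↥(adjoin ℚ (Set.range ![w, s])) :=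
    le_trdeg_of_algebraicIndependent_mem _ hind (fun i => subset_adjoin ℚ _ ⟨i, rfl⟩)
  have hle : adjoin ℚ (insert d (Set.range ![w, s])) ≤ adjoin ℚ (Set.range ![d, w, s]) := by
    refine adjoin_le_iff.mpr (Set.insert_subset (subset_adjoin ℚ _ ⟨0, by simp⟩) (Set.range_subset_iff.mpr ?_))
    intro i; fin_cases i
    · exact subset_adjoin ℚ _ ⟨1, by simp⟩
    · exact subset_adjoin ℚ _ ⟨2, by simp⟩
  have h3' : ((2 + 1 : ℕ) : Cardinal) ≤ Algebra.trdeg ℚ ↥(adjoin ℚ (insert d (Set.range ![w, s]))) :=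
    natCast_succ_le_trdeg_adjoin_insert h2 hd ((trdeg_mono hle).trans (trdeg_adjoin_range_le _))
  have h3 : ((3 : ℕ) : Cardinal) ≤ Algebra.trdeg ℚ ↥(adjoin ℚ (Set.range ![d, w, s])) := h3'.trans (trdeg_mono hle)
  exact hQ0 (algebraicIndependent_iff.mp (algebraicIndependent_of_le_trdeg_adjoin _ h3) Q hQ)

/-- SPECIALISATION: if `Q(u·w + v, w, s) = 0` and `w` is transcendental over `ℚ(u, v, s)`, then `Q(u·y + v, y, s) = 0` for EVERY
`y ∈ ℂ` (the relation, read as a polynomial in `w` over `ℚ(u, v, s)`, vanishes identically). [folklore] -/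
theorem relation_specialise {Q : MvPolynomial (Fin 3) ℚ} {u v w s : ℂ}
    (hQ : MvPolynomial.aeval ![u * w + v, w, s] Q = 0)
    (hw : Transcendental ↥(adjoin ℚ (Set.range ![u, v, s])) w) (y : ℂ) :
    MvPolynomial.aeval ![u * y + v, y, s] Q = 0 := by
  set K₁ : IntermediateField ℚ ℂ := adjoin ℚ (Set.range ![u, v, s]) with hK₁
  have hu : u ∈ K₁ := subset_adjoin ℚ _ ⟨0, by simp⟩
  have hv : v ∈ K₁ := subset_adjoin ℚ _ ⟨1, by simp⟩
  have hs : s ∈ K₁ := subset_adjoin ℚ _ ⟨2, by simp⟩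
  -- the relation as a univariate polynomial over `K₁`
  let g : Fin 3 → Polynomial ↥K₁ :=
    ![Polynomial.C (⟨u, hu⟩ : ↥K₁) * Polynomial.X + Polynomial.C (⟨v, hv⟩ : ↥K₁), Polynomial.X,
      Polynomial.C (⟨s, hs⟩ : ↥K₁)]
  let P₁ : Polynomial ↥K₁ := MvPolynomial.aeval g Q
  have hP₁ : ∀ y : ℂ, Polynomial.aeval y P₁ = MvPolynomial.aeval ![u * y + v, y, s] Q := by
    intro y
    have h := MvPolynomial.comp_aeval (R := ℚ) ((Polynomial.aeval y : Polynomial ↥K₁ →ₐ[↥K₁] ℂ).restrictScalars ℚ)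
      (f := g)
    have h' := AlgHom.congr_fun h Q
    simp only [AlgHom.comp_apply, AlgHom.restrictScalars_apply] at h'
    have hfun : (fun i => (Polynomial.aeval y : Polynomial ↥K₁ →ₐ[↥K₁] ℂ) (g i)) = ![u * y + v, y, s] := by
      funext i
      fin_cases i <;> simp [g]
    rw [show (P₁ : Polynomial ↥K₁) = MvPolynomial.aeval g Q from rfl, h', hfun]
  have hP₁zero : P₁ = 0 := by
    by_contra hne
    exact hw ⟨P₁, hne, by rw [hP₁ w]; exact hQ⟩
  rw [← hP₁ y, hP₁zero, map_zero]

/-- **NON-MODULARITY OF `(ℂ, acl)` (Pillay's example).**  If `u, v, w` are algebraically independent over `ℚ` and `s` is algebraic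
over `ℚ(u, v)` AND over `ℚ(uw + v, w)`, then `s ∈ ℚ̄`:  `ℚ(u,v)^alg ∩ ℚ(uw+v, w)^alg = ℚ̄` although both have dimension 2
inside the 3-dimensional `ℚ(u,v,w)^alg`.  [Pillay, Geometric Stability Theory (1996), Ch. 2, Example 1.8; this node] -/
theorem isAlgebraic_of_nonmodular {u v w s : ℂ} (h : AlgebraicIndependent ℚ ![u, v, w])
    (hsA : IsAlgebraic ↥(adjoin ℚ (Set.range ![u, v])) s)
    (hsB : IsAlgebraic ↥(adjoin ℚ (Set.range ![u * w + v, w])) s) : IsAlgebraic ℚ s := by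
  by_contra hs
  -- the three transcendence-degree facts that drive everything
  have h3 : ((3 : ℕ) : Cardinal) ≤ Algebra.trdeg ℚ ↥(adjoin ℚ (Set.range ![u, v, w])) :=
    le_trdeg_of_algebraicIndependent_mem _ h (fun i => subset_adjoin ℚ _ ⟨i, rfl⟩)
  have hA2 : Algebra.trdeg ℚ ↥(adjoin ℚ (Set.range ![u, v])) ≤ ((2 : ℕ) : Cardinal) := trdeg_adjoin_range_le _
  have hB2 : Algebra.trdeg ℚ ↥(adjoin ℚ (Set.range ![u * w + v, w])) ≤ ((2 : ℕ) : Cardinal) := trdeg_adjoin_range_le _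
  -- generic tool: `u, v, w` algebraic over a field of trdeg ≤ 2 is absurd
  have absurd₂ : ∀ K : IntermediateField ℚ ℂ, Algebra.trdeg ℚ ↥K ≤ ((2 : ℕ) : Cardinal) →
      IsAlgebraic ↥K u → IsAlgebraic ↥K v → IsAlgebraic ↥K w → False := by
    intro K hK hu hv hw
    have hle : Algebra.trdeg ℚ ↥(adjoin ℚ (Set.range ![u, v, w])) ≤ Algebra.trdeg ℚ ↥K := by
      refine trdeg_adjoin_le_of_isAlgebraic ?_
      rintro _ ⟨i, rfl⟩
      fin_cases i
      · simpa using hu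
      · simpa using hv
      · simpa using hw
    have : ((3 : ℕ) : Cardinal) ≤ ((2 : ℕ) : Cardinal) := h3.trans (hle.trans hK)
    have : (3 : ℕ) ≤ 2 := by exact_mod_cast this
    omega
  have huA : u ∈ adjoin ℚ (Set.range ![u, v]) := subset_adjoin ℚ _ ⟨0, by simp⟩
  have hvA : v ∈ adjoin ℚ (Set.range ![u, v]) := subset_adjoin ℚ _ ⟨1, by simp⟩
  -- (2) the relation `Q(uw+v, w, s) = 0`
  obtain ⟨Q, hQ, hQ0⟩ : ∃ Q : MvPolynomial (Fin 3) ℚ, MvPolynomial.aeval ![u * w + v, w, s] Q = 0 ∧ Q ≠ 0 := by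
    by_contra hnone
    push Not at hnone
    have hind : AlgebraicIndependent ℚ ![u * w + v, w, s] := algebraicIndependent_iff.mpr hnone
    have h3' : ((3 : ℕ) : Cardinal) ≤ Algebra.trdeg ℚ ↥(adjoin ℚ (Set.range ![u * w + v, w, s])) :=
      le_trdeg_of_algebraicIndependent_mem _ hind (fun i => subset_adjoin ℚ _ ⟨i, rfl⟩)
    have hle : Algebra.trdeg ℚ ↥(adjoin ℚ (Set.range ![u * w + v, w, s])) ≤
        Algebra.trdeg ℚ ↥(adjoin ℚ (Set.range ![u * w + v, w])) := by
      refine trdeg_adjoin_le_of_isAlgebraic ?_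
      rintro _ ⟨i, rfl⟩
      fin_cases i
      · simpa using isAlgebraic_of_mem_adjoin (subset_adjoin ℚ (Set.range ![u * w + v, w]) ⟨0, by simp⟩)
      · simpa using isAlgebraic_of_mem_adjoin (subset_adjoin ℚ (Set.range ![u * w + v, w]) ⟨1, by simp⟩)
      · simpa using hsB
    have : ((3 : ℕ) : Cardinal) ≤ ((2 : ℕ) : Cardinal) := h3'.trans (hle.trans hB2)
    have : (3 : ℕ) ≤ 2 := by exact_mod_cast this
    omega
  -- (3) `w` is transcendental over `K₁ = ℚ(u, v, s)` (a field of trdeg ≤ 2 containing `u, v`)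
  have hK₁ : Algebra.trdeg ℚ ↥(adjoin ℚ (Set.range ![u, v, s])) ≤ ((2 : ℕ) : Cardinal) := by
    refine (trdeg_adjoin_le_of_isAlgebraic ?_).trans hA2
    rintro _ ⟨i, rfl⟩
    fin_cases i
    · simpa using isAlgebraic_of_mem_adjoin huA
    · simpa using isAlgebraic_of_mem_adjoin hvA
    · simpa using hsA
  have hw : Transcendental ↥(adjoin ℚ (Set.range ![u, v, s])) w := fun hw =>
    absurd₂ _ hK₁ (isAlgebraic_of_mem_adjoin (subset_adjoin ℚ _ ⟨0, by simp⟩))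
      (isAlgebraic_of_mem_adjoin (subset_adjoin ℚ _ ⟨1, by simp⟩)) hw
  -- (4) hence `Q(u y + v, y, s) = 0` for every `y`
  have hspec := relation_specialise hQ hw
  -- (5) `(w', s)` is algebraically independent for `w' = w` and `w' = w + 1`
  have hind : ∀ c : ℚ, AlgebraicIndependent ℚ ![w + c, s] := by
    intro c
    have h1 : ((1 : ℕ) : Cardinal) ≤ Algebra.trdeg ℚ ↥(adjoin ℚ ({s} : Set ℂ)) := one_le_trdeg_adjoin_singleton hs
    have hn : ¬ IsAlgebraic ↥(adjoin ℚ ({s} : Set ℂ)) (w + c) := by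
      intro hwc
      have hwc' : IsAlgebraic ↥(adjoin ℚ (Set.range ![u, v])) (w + c) :=
        isAlgebraic_of_isAlgebraic_adjoin _ (by intro x hx; rw [Set.mem_singleton_iff.mp hx]; exact hsA) hwc
      have hw' : IsAlgebraic ↥(adjoin ℚ (Set.range ![u, v])) w := by
        have := isAlgebraic_sub hwc' (isAlgebraic_of_mem_adjoin (L := adjoin ℚ (Set.range ![u, v]))
          (SubfieldClass.ratCast_mem (adjoin ℚ (Set.range ![u, v])) c))
        simpa using this
      exact absurd₂ _ hA2 (isAlgebraic_of_mem_adjoin huA) (isAlgebraic_of_mem_adjoin hvA) hw'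
    have hle : adjoin ℚ (insert (w + c) ({s} : Set ℂ)) ≤ adjoin ℚ (Set.range ![w + (c : ℂ), s]) :=
      adjoin_le_iff.mpr (Set.insert_subset (subset_adjoin ℚ _ ⟨0, by simp⟩)
        (Set.singleton_subset_iff.mpr (subset_adjoin ℚ _ ⟨1, by simp⟩)))
    have h2 := natCast_succ_le_trdeg_adjoin_insert h1 hn ((trdeg_mono hle).trans (trdeg_adjoin_range_le _))
    exact algebraicIndependent_of_le_trdeg_adjoin _ (h2.trans (trdeg_mono hle))
  -- (6) `uw + v` and `u(w+1) + v` are algebraic over `K₂ = ℚ(w, s)`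
  set K₂ : IntermediateField ℚ ℂ := adjoin ℚ (Set.range ![w, s]) with hK₂def
  have hwK₂ : w ∈ K₂ := subset_adjoin ℚ _ ⟨0, by simp⟩
  have hsK₂ : s ∈ K₂ := subset_adjoin ℚ _ ⟨1, by simp⟩
  have hd : IsAlgebraic ↥K₂ (u * w + v) := by
    have := isAlgebraic_of_relation hQ0 (hspec w) (by simpa using hind 0)
    simpa using this
  have hd' : IsAlgebraic ↥K₂ (u * (w + 1) + v) := by
    have h' := isAlgebraic_of_relation hQ0 (hspec (w + 1)) (by simpa using hind 1)
    refine isAlgebraic_of_isAlgebraic_adjoin K₂ ?_ h'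
    rintro _ ⟨i, rfl⟩
    fin_cases i
    · simpa using isAlgebraic_of_mem_adjoin (add_mem hwK₂ (one_mem K₂))
    · simpa using isAlgebraic_of_mem_adjoin hsK₂
  -- (7) so `u, v, w` are algebraic over `K₂`, a field of trdeg ≤ 2: absurd
  have hu : IsAlgebraic ↥K₂ u := by
    have := isAlgebraic_sub hd' hd
    have e : u * (w + 1) + v - (u * w + v) = u := by ring
    simpa [e] using this
  have hv : IsAlgebraic ↥K₂ v := by
    have := isAlgebraic_sub hd (isAlgebraic_mul' hu (isAlgebraic_of_mem_adjoin hwK₂))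
    have e : u * w + v - u * w = v := by ring
    simpa [e] using this
  exact absurd₂ K₂ (trdeg_adjoin_range_le _) hu hv (isAlgebraic_of_mem_adjoin hwK₂)


/-- The same with a fourth independent coordinate `f` allowed on the second side: if `u, v, w, f` are algebraically independent and
`s` is algebraic over `ℚ(u, v)` and over `ℚ(uw + v, w, f)`, then `s ∈ ℚ̄` (first `s ∈ ℚ(uw+v, w)^alg` by a degree count, then
`isAlgebraic_of_nonmodular`). [this node] -/
theorem isAlgebraic_of_nonmodular₄ {u v w f s : ℂ} (h : AlgebraicIndependent ℚ ![u, v, w, f])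
    (hsA : IsAlgebraic ↥(adjoin ℚ (Set.range ![u, v])) s)
    (hsB : IsAlgebraic ↥(adjoin ℚ (Set.range ![u * w + v, w, f])) s) : IsAlgebraic ℚ s := by
  have h3 : AlgebraicIndependent ℚ ![u, v, w] := by
    have h' := h.comp Fin.castSucc (Fin.castSucc_injective _)
    have e : (![u, v, w, f] ∘ Fin.castSucc : Fin 3 → ℂ) = ![u, v, w] := by
      funext i; fin_cases i <;> rfl
    rwa [e] at h'
  by_contra hs
  refine hs (isAlgebraic_of_nonmodular h3 hsA ?_)
  -- (a) `s` is algebraic over `ℚ(uw + v, w)` already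
  by_contra hn
  have h4 : ((4 : ℕ) : Cardinal) ≤ Algebra.trdeg ℚ ↥(adjoin ℚ (Set.range ![u, v, w, f])) :=
    le_trdeg_of_algebraicIndependent_mem _ h (fun i => subset_adjoin ℚ _ ⟨i, rfl⟩)
  have h3c : ((3 : ℕ) : Cardinal) ≤ Algebra.trdeg ℚ ↥(adjoin ℚ (Set.range ![u, v, w])) :=
    le_trdeg_of_algebraicIndependent_mem _ h3 (fun i => subset_adjoin ℚ _ ⟨i, rfl⟩)
  set B : Set ℂ := Set.range ![u * w + v, w] with hBdef
  -- trdeg ℚ(uw+v, w) = 2, because ℚ(u, v, w) ≤ ℚ(uw+v, w, u)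
  have hle1 : adjoin ℚ (Set.range ![u, v, w]) ≤ adjoin ℚ (insert u B) := by
    have hu : u ∈ adjoin ℚ (insert u B) := subset_adjoin ℚ _ (Set.mem_insert _ _)
    have hd : u * w + v ∈ adjoin ℚ (insert u B) := subset_adjoin ℚ _ (Set.mem_insert_of_mem _ ⟨0, by simp⟩)
    have hw : w ∈ adjoin ℚ (insert u B) := subset_adjoin ℚ _ (Set.mem_insert_of_mem _ ⟨1, by simp⟩)
    have hv : v ∈ adjoin ℚ (insert u B) := by
      have e : v = (u * w + v) - u * w := by ring
      rw [e]; exact sub_mem hd (mul_mem hu hw)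
    refine adjoin_range_le ?_
    intro i; fin_cases i
    · exact hu
    · exact hv
    · exact hw
  have hB2 : ((2 : ℕ) : Cardinal) ≤ Algebra.trdeg ℚ ↥(adjoin ℚ B) := by
    have hh := (h3c.trans (trdeg_mono hle1)).trans
      (Literature.NumberTheory.Transcendental.trdeg_adjoin_insert_le B u)
    obtain ⟨k, hk, -⟩ := exists_nat_eq_of_le_natCast (trdeg_adjoin_range_le ![u * w + v, w])
    have hh' : ((3 : ℕ) : Cardinal) ≤ (k : Cardinal) + 1 := hh.trans (add_le_add hk.le le_rfl)
    have : (3 : ℕ) ≤ k + 1 := by exact_mod_cast hh'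
    exact le_of_le_of_eq (by exact_mod_cast (by omega : 2 ≤ k)) hk.symm
  -- so trdeg ℚ(uw+v, w, s) = 3 (as `s` is transcendental over `ℚ(B)`)
  have hS3 : ((2 + 1 : ℕ) : Cardinal) ≤ Algebra.trdeg ℚ ↥(adjoin ℚ (insert s B)) := by
    refine natCast_succ_le_trdeg_adjoin_insert hB2 hn ?_
    calc Algebra.trdeg ℚ ↥(adjoin ℚ (insert s B)) ≤ Algebra.trdeg ℚ ↥(adjoin ℚ B) + 1 :=
          Literature.NumberTheory.Transcendental.trdeg_adjoin_insert_le B s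
      _ ≤ ((2 : ℕ) : Cardinal) + 1 := add_le_add (trdeg_adjoin_range_le _) le_rfl
      _ = ((2 + 1 : ℕ) : Cardinal) := by norm_cast
  -- while ℚ(uw+v, w, f, s) has trdeg ≤ 3 and contains `f`
  have hT3 : Algebra.trdeg ℚ ↥(adjoin ℚ (insert s (Set.range ![u * w + v, w, f]))) ≤ ((2 + 1 : ℕ) : Cardinal) := by
    rw [trdeg_adjoin_insert_eq_of_isAlgebraic hsB]; exact trdeg_adjoin_range_le _
  have hST : insert s B ⊆ insert s (Set.range ![u * w + v, w, f]) := by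
    refine Set.insert_subset_insert ?_
    rintro _ ⟨i, rfl⟩
    fin_cases i
    · exact ⟨0, by simp⟩
    · exact ⟨1, by simp⟩
  have hf : IsAlgebraic ↥(adjoin ℚ (insert s B)) f :=
    isAlgebraic_of_trdeg_sandwich
      (subset_adjoin ℚ (insert s (Set.range ![u * w + v, w, f])) (Set.mem_insert_of_mem s ⟨2, by simp⟩)) hST hT3 hS3
  -- hence `f` is algebraic over `K₃ = ℚ(u, v, w)`: contradiction with the independence of `u, v, w, f`
  set K₃ : IntermediateField ℚ ℂ := adjoin ℚ (Set.range ![u, v, w]) with hK₃def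
  have huK : u ∈ K₃ := subset_adjoin ℚ _ ⟨0, by simp⟩
  have hvK : v ∈ K₃ := subset_adjoin ℚ _ ⟨1, by simp⟩
  have hwK : w ∈ K₃ := subset_adjoin ℚ _ ⟨2, by simp⟩
  have hAK : adjoin ℚ (Set.range ![u, v]) ≤ K₃ := by
    refine adjoin_range_le ?_
    intro i; fin_cases i
    · exact huK
    · exact hvK
  have hfK : IsAlgebraic ↥K₃ f := by
    refine isAlgebraic_of_isAlgebraic_adjoin K₃ ?_ hf
    rintro x (rfl | ⟨i, rfl⟩)
    · exact isAlgebraic_of_le hAK hsA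
    · fin_cases i
      · simpa using isAlgebraic_of_mem_adjoin (add_mem (mul_mem huK hwK) hvK)
      · simpa using isAlgebraic_of_mem_adjoin hwK
  have hle : Algebra.trdeg ℚ ↥(adjoin ℚ (Set.range ![u, v, w, f])) ≤ Algebra.trdeg ℚ ↥K₃ := by
    refine trdeg_adjoin_le_of_isAlgebraic ?_
    rintro _ ⟨i, rfl⟩
    fin_cases i
    · simpa using isAlgebraic_of_mem_adjoin huK
    · simpa using isAlgebraic_of_mem_adjoin hvK
    · simpa using isAlgebraic_of_mem_adjoin hwK
    · simpa using hfK
  have : ((4 : ℕ) : Cardinal) ≤ ((3 : ℕ) : Cardinal) := h4.trans (hle.trans (trdeg_adjoin_range_le _))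
  have : (4 : ℕ) ≤ 3 := by exact_mod_cast this
  omega

end Summit.Schanuel.Schanuel.Theorems.RootDecomp1ModularLayer

end
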